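import Mathlib.RingTheory.MvPowerSeries.Substitution
import Mathlib.RingTheory.MvPowerSeries.Equiv
import Mathlib.RingTheory.MvPowerSeries.Order
import Mathlib.LinearAlgebra.Matrix.GeneralLinearGroup.Defs
import Mathlib.Data.Nat.Choose.Lucas
import Literature.NumberTheory.EllipticCurves.IwasawaAlgebraGeneratorChange
import Literature.NumberTheory.IwasawaTheory.IwasawaAlgebraTwoVar
import Literature.NumberTheory.EllipticCurves.ZpExtension
import HarnessLib

/-!
# Two-variable generator change («frame substitution») of the Iwasawa algebra
# `Λ₂(𝒪) = 𝒪⟦T₂⟧⟦T₁⟧`: `φ_A : 1 + T₁ ↦ (1+T₁)^a (1+T₂)^c`, `1 + T₂ ↦ (1+T₁)^b (1+T₂)^d`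
# for `A = (a b; c d) ∈ GL₂(ℤ_p)` — definitions with bodies and proved API, no named fact

Topic `NumberTheory/EllipticCurves` (namespace = path, sub-namespace `IwasawaAlgebra₂` after the
tree's `IwasawaAlgebra₂ p = PowerSeries (IwasawaAlgebra p)` of `Rubin1991/TwoVariableMainConjecture`).
Definition item `defn-IwasawaAlgebra₂.frameSubst` (planner `bsd-wall-pss3x` g7 for `thin_comb` v2 on
item stmt-BirchSwinnertonDyer-20395, lead `cruxlead-20395` note (ii)): the RANK-TWO analogue of the
one-variable generator change `GeneratorChange.subst c` / `substEquiv c` (`1 + T ↦ (1+T)^c`) of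
`IwasawaAlgebraGeneratorChange.lean`. Everything here is PROVED `ℤ_p`/`𝒪`-algebra; there is no
number theory, no `instance`, no notation, no `sorry`, no named fact. Nothing about elliptic curves,
the wall `AdditiveSplitIMCInclusionAtThree`, the two-variable functional equation (K4) or BSD is
claimed: BSD is not proved by any of this.

## The mathematics

For a profinite group `Γ = ℤ_p γ₁ ⊕ ℤ_p γ₂ ≅ ℤ_p²` and a `ℤ_p`-algebra `𝒪`, `𝒪⟦Γ⟧ ≅ 𝒪⟦T₁, T₂⟧` by
`γ_i ↦ 1 + T_i`, and `γ₁^x γ₂^y ↦ (1+T₁)^x (1+T₂)^y` with `(1+T)^x = Σₙ (x choose n) Tⁿ` the binomial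
series (the Mahler-transform dictionary: the Dirac measure at `x` has moments `(x choose n)`;
[CoatesSujatha2006Cyclotomic] Lemma 3.3.4, [NeukirchSchmidtWingberg2008] (5.3.5), [Lang1990] Ch. 5 §1
Thm. 1.1 — "the isomorphism depends on the choice of generator"). A change of topological basis
`γ₁ ↦ γ₁^a γ₂^c`, `γ₂ ↦ γ₁^b γ₂^d`, `A = (a b; c d) ∈ GL₂(ℤ_p)`, therefore induces the `𝒪`-algebra
automorphism `φ_A` of `𝒪⟦T₁, T₂⟧` with `T_j ↦ (1+T₁)^{A 0 j} (1+T₂)^{A 1 j} − 1` (column `j` of `A` =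
exponents of the image of `1 + T_j`; `a = A 0 0`, `c = A 1 0`, `b = A 0 1`, `d = A 1 1`).

CONSTRUCTION. On `MvPowerSeries (Fin 2) 𝒪` the substitution is Mathlib's `MvPowerSeries.substAlgHom`
at the images `frameImages 𝒪 A` (zero constant terms); it is transported to the tree's NESTED model
`PowerSeries (PowerSeries 𝒪)` (outer `T₁ = X`, inner `T₂ = C X`, constants `C (C r)`) along the tree's
`nestedPowerSeriesEquiv : 𝒪⟦T₂⟧⟦T₁⟧ ≃+* 𝒪⟦T₁, T₂⟧` (`IwasawaTheory/IwasawaAlgebraTwoVar.lean`; Mathlib's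
own substitution cannot act on the inner variable of the nested ring, whose constant coefficient `X`
is not nilpotent). The one identity that is not formal — `((1+T₁)^{y₀} (1+T₂)^{y₁})^x =
(1+T₁)^{y₀x} (1+T₂)^{y₁x}` for `p`-ADIC `x` (`subst_binomialSeries_eq`) — is proved over `ℤ_p` by
continuity of all coefficients in `x` (Mahler, `PadicInt.continuous_choose`) and density of `ℕ`
(where it is `(uv)^m = u^m v^m`), exactly as `binomialSeries_mul_eq_subst` in the one-variable file,
and base-changed to `𝒪` with `MvPowerSeries.map_subst`. The composition law then follows from
`MvPowerSeries.subst_comp_subst`.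

## Contents (the API asked for by the item, numbered as there)

* §1 `onePlusXPow 𝒪 i x = (1+T_i)^x ∈ 𝒪⟦T₁,T₂⟧` (+ `_add`, `_zero`, `_natCast`, `_one`, `_mul_natCast`,
  `_neg_mul_self`, `isUnit_`, `coeff_`, `constantCoeff_`, `map_onePlusXPow`, `map_binomialSeries`);
  §2 `subst_binomialSeries_eq_int`, `subst_binomialSeries_eq`.
* §3 `frameMonomial`, `frameImages`, `hasSubst_frameImages`, `frameSubstMv 𝒪 A` (any matrix `A`) with
  `frameSubstMv_X/_one_add_X/_C/_onePlusXPow/_frameMonomial/_frameImages`,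
  **`frameSubstMv_frameSubstMv`** (`φ_A (φ_B f) = φ_{AB} f`), `frameImages_one`, `frameSubstMv_one`.
* §4 nested dictionary `nestedPowerSeriesEquiv_map_C` (`Σ C(fₙ)T₁ⁿ ↦ f(X₀)`), `nestedPowerSeriesEquiv_C`
  (`C g ↦ g(X₁)`), `…_onePlusT₁Pow/T₂Pow`; `frameSubstRingHom 𝒪 A` (any `A`) and its API.
* §5 **`frameSubst 𝒪 (A : GL (Fin 2) ℤ_[p]) : PowerSeries (PowerSeries 𝒪) ≃+* PowerSeries (PowerSeries 𝒪)`**: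
  (1) `frameSubst_C_C` (fixes `const 𝒪 r = C (C r)`); (2) `frameSubst_one` (`= RingEquiv.refl`),
  **`frameSubst_mul`** (ORDER: `frameSubst (A * B) F = frameSubst A (frameSubst B F)`, also
  `frameSubst_mul_eq_trans`), `frameSubst_symm` (inverse `= frameSubst A⁻¹`); (3) `frameSubst_one_add_X`
  (`= PowerSeries.map C (binomialSeries 𝒪 a) * C (binomialSeries 𝒪 c)`, i.e. `(1+T₁)^a (1+T₂)^c` with
  `(1+T₁)^x` spelled `PowerSeries.map C (PowerSeries.binomialSeries 𝒪 x)` and `(1+T₂)^y` spelled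
  `C (PowerSeries.binomialSeries 𝒪 y)`; `binomialSeries 𝒪 x` takes the `p`-adic exponent directly, no
  `map` along `ℤ_p → 𝒪` is needed, cf. `map_binomialSeries`), `frameSubst_one_add_C_X`, `frameSubst_X`,
  `frameSubst_C_X`, `frameSubst_onePlusT₁Pow/T₂Pow`.
* §6 (4) named frames: `swapFrame` (`frameSubst_swapFrame_X : T₁ ↦ T₂`, `…_C_X : T₂ ↦ T₁`),
  `reflectionFrame = (0 −1; −1 0)` with **`frameSubst_reflectionFrame_isReflection`** — the three clauses
  of `IsReflection` of `Summits/…/Theorems/UniversalToricDescentThinCombDefs` spelled out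
  (`(1+T₂)(1+φT₁) = 1`, `(1+T₁)(1+φT₂) = 1`, constants fixed): an ACTUAL reflection for the route;
  `diagFrame u v` with `frameSubst_diagFrame_one_add_X` (`1+T₁ ↦ (1+T₁)^u`, the one-variable
  `GeneratorChange.subst u` on the outer generator) and `…_one_add_C_X` (`1+T₂ ↦ (1+T₂)^v`).
  TODO(general form): the identities OF MAPS `frameSubst (diagFrame 1 v) = PowerSeries.map (substEquiv v)`
  and `frameSubst (diagFrame u 1) = PowerSeries.subst (map C ((1+X)^u − 1))` are only given on the
  generators `1 + T₁`, `1 + T₂`, `C (C r)` here.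
* §7 (5) **`frameSubst_C_X_mem_span_iff` / `frameSubst_C_X_not_mem_span_iff`**: for `¬ IsUnit (p : 𝒪)`,
  `φ_A(T₂) ∈ (C (C p), C X)` iff `b = A 0 1 = 0` (so `∉` iff `b ≠ 0`) — `b = 0`: `(1+T₂)^d − 1 ∈ (T₂)`;
  `b = u p^e ≠ 0`: the `T₁^{p^e} T₂^0`-coefficient is `(b choose p^e) ≡ u ≢ 0 (mod p)` (Lucas,
  `choose_mul_prime_pow_modEq`, `prime_dvd_choose_mul_pow_sub` — the `p`-adic case again by density);
  `not_isUnit_natCast_padicInt` discharges the hypothesis for `𝒪 = ℤ_p`.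
* §8 (6) Galois dictionary `frameMatrixOf κ₁ κ₂ γ₁ γ₂ σ = (κ₁(σγ₁) κ₁(σγ₂); κ₂(σγ₁) κ₂(σγ₂))` (additive
  coordinates of `σγ_j` in a generator pair of the `ℤ_p²`-tower, `ZpExtension`), `frameMatrixOf_id`.
  Statement-level bookkeeping: that conjugation by `c` (or `c∘ι`) acts on a pinned two-variable module
  through `frameSubst 𝒪 (frameMatrixOf …)` is for the route's frame stubs to assert, not this file.

## References

* [NeukirchSchmidtWingberg2008] J. Neukirch, A. Schmidt, K. Wingberg, *Cohomology of Number Fields*,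
  2nd ed. (2008), Prop. (5.3.5) (`𝒪⟦G⟧ ≅ 𝒪⟦X₁,…,X_d⟧` for `G ≅ ℤ_p^d`, `γ_i ↦ 1 + X_i`). (Not held in
  the local store; cited as in `IwasawaAlgebraGeneratorChange.lean`.)
* [CoatesSujatha2006Cyclotomic] J. Coates, R. Sujatha, *Cyclotomic Fields and Zeta Values* (2006),
  Lemma 3.3.4 (PDF p. 32: the unique topological isomorphism `Λ(ℤ_p) ≅ ℤ_p⟦T⟧` with `γ ↦ 1 + T`;
  Mahler coefficients `c_n(λ) = ∫ (x choose n) dλ`, so `γ^x ↦ Σ (x choose n) Tⁿ`). Held, verified.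
* [Lang1990] S. Lang, *Cyclotomic Fields I and II*, GTM 121, Ch. 5 §1, Thm. 1.1 (PDF p. 94:
  `ℤ_p⟦X⟧ ≅ lim ℤ_p[Γ_n]`, "the isomorphism depends on the original choice of generator `γ`"; the
  maximal ideal `(p, X)`). Held, verified.
* [Washington1997] L. C. Washington, *Introduction to Cyclotomic Fields*, §13.2 (as in the one-variable file).
* [Cai2020] T. Cai, *A Modern Introduction to Classical Number Theory* (2020), Thm. 3.15 (Lucas) (PDF
  p. 98). Held, verified. Mathlib: `Choose.choose_modEq_choose_mod_mul_choose_div_nat`.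
* Tree: `IwasawaAlgebraGeneratorChange.lean` (one variable), `IwasawaTheory/IwasawaAlgebraTwoVar.lean`
  (`nestedPowerSeriesEquiv`), `ZpExtension.lean`, `Rubin1991/TwoVariableMainConjecture.lean`
  (`IwasawaAlgebra₂`, `ZpExtension.IsTopGeneratorPair`), `Summits/…/UniversalToricDescentThinCombDefs.lean`
  (`T₁`, `T₂`, `const`, `IsReflection` — not importable from Literature; spelled out here).
-/

noncomputable section

open Literature.NumberTheory.IwasawaTheory

namespace Literature.NumberTheory.EllipticCurves

namespace IwasawaAlgebra₂

variable {p : ℕ} [Fact p.Prime]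

/-! ## §0 Two coefficient formulas -/

/-- The coefficient of `T^e` in `f(ω)` for a one-variable `f` and a multivariate `ω` with `ω(0) = 0`
is the FINITE sum `Σ_{n ≤ |e|} [Xⁿ]f · [T^e]ωⁿ` (`ωⁿ` has order `≥ n`; private helper). [folklore] -/
private theorem coeff_subst_eq_sum_of_constantCoeff_eq_zero {R : Type*} [CommRing R] {τ : Type*}
    {ω : MvPowerSeries τ R} (hω : MvPowerSeries.constantCoeff ω = 0) (f : PowerSeries R)
    (e : τ →₀ ℕ) :
    MvPowerSeries.coeff e (f.subst ω) =
      ∑ n ∈ Finset.range (e.degree + 1), PowerSeries.coeff n f * MvPowerSeries.coeff e (ω ^ n) := by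
  rw [PowerSeries.coeff_subst (PowerSeries.HasSubst.of_constantCoeff_zero hω),
    finsum_eq_sum_of_support_subset _ (s := Finset.range (e.degree + 1)) ?_]
  · simp only [smul_eq_mul]
  · intro n hn
    simp only [Function.mem_support, ne_eq, Finset.coe_range, Set.mem_Iio] at hn ⊢
    by_contra hlt
    apply hn
    rw [MvPowerSeries.coeff_of_lt_order, smul_zero]
    calc (e.degree : ℕ∞) < n := by exact_mod_cast (by omega)
      _ ≤ (ω ^ n).order := MvPowerSeries.le_order_pow_of_constantCoeff_eq_zero n hω

/-- Coefficients of a one-variable series placed in the variable `i`: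
`[T^e] f(T_i) = [X^{e i}] f` if `e` is supported on `{i}`, else `0` (private helper). [folklore] -/
private theorem coeff_toMvPowerSeries {R : Type*} [CommRing R] {σ : Type*} [DecidableEq σ]
    (f : PowerSeries R) (i : σ) (e : σ →₀ ℕ) :
    MvPowerSeries.coeff e (PowerSeries.toMvPowerSeries i f) =
      if e = Finsupp.single i (e i) then PowerSeries.coeff (e i) f else 0 := by
  rw [PowerSeries.toMvPowerSeries_eq_subst,
    coeff_subst_eq_sum_of_constantCoeff_eq_zero (MvPowerSeries.constantCoeff_X i)]
  simp_rw [MvPowerSeries.coeff_X_pow]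
  split_ifs with he
  · rw [Finset.sum_eq_single (e i)]
    · rw [if_pos he, mul_one]
    · intro n _ hn
      rw [if_neg, mul_zero]
      intro h
      apply hn
      rw [h, Finsupp.single_eq_same]
    · intro h
      exfalso
      apply h
      rw [Finset.mem_range, Nat.lt_succ_iff]
      conv_rhs => rw [he]
      rw [Finsupp.degree_single]
  · refine Finset.sum_eq_zero fun n _ ↦ ?_
    rw [if_neg, mul_zero]
    intro h
    apply he
    conv_lhs => rw [h]
    rw [h, Finsupp.single_eq_same]

/-! ## §1 The binomial powers `(1 + T_i)^x` (`x ∈ ℤ_p`) in `𝒪⟦T₁, T₂⟧` -/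

variable (𝒪 : Type*) [CommRing 𝒪] [Algebra ℤ_[p] 𝒪]

/-- **`(1 + T_i)^x ∈ 𝒪⟦T₁, T₂⟧`** for a `p`-adic exponent `x ∈ ℤ_p`: the binomial series
`Σₙ (x choose n) T_iⁿ` (`PowerSeries.binomialSeries 𝒪 x`) placed in the variable `i ∈ {0, 1}` of
`MvPowerSeries (Fin 2) 𝒪` — the image of `γ_i^x` under `𝒪⟦ℤ_p²⟧ ≅ 𝒪⟦T₁, T₂⟧`, `γ_i ↦ 1 + T_i`
(Mahler: the Dirac measure at `x` has moments `(x choose n)`).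
[cite: CoatesSujatha2006Cyclotomic, Lemma 3.3.4 (p. 32)] [cite: NeukirchSchmidtWingberg2008, (5.3.5)] -/
def onePlusXPow (i : Fin 2) (x : ℤ_[p]) : MvPowerSeries (Fin 2) 𝒪 :=
  PowerSeries.toMvPowerSeries i (PowerSeries.binomialSeries 𝒪 x)

/-- Unfolding `onePlusXPow`. [cite: NeukirchSchmidtWingberg2008, (5.3.5)] -/
theorem onePlusXPow_def (i : Fin 2) (x : ℤ_[p]) :
    onePlusXPow 𝒪 i x = PowerSeries.toMvPowerSeries i (PowerSeries.binomialSeries 𝒪 x) := rfl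

/-- `(1+T_i)^{x+y} = (1+T_i)^x (1+T_i)^y`. [cite: NeukirchSchmidtWingberg2008, (5.3.5)] -/
theorem onePlusXPow_add (i : Fin 2) (x y : ℤ_[p]) :
    onePlusXPow 𝒪 i (x + y) = onePlusXPow 𝒪 i x * onePlusXPow 𝒪 i y := by
  rw [onePlusXPow, PowerSeries.binomialSeries_add, map_mul, onePlusXPow, onePlusXPow]

/-- `(1+T_i)^0 = 1`. [cite: NeukirchSchmidtWingberg2008, (5.3.5)] -/
@[simp] theorem onePlusXPow_zero (i : Fin 2) : onePlusXPow 𝒪 i (0 : ℤ_[p]) = 1 := by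
  rw [onePlusXPow, PowerSeries.binomialSeries_zero, map_one]

/-- `(1+T_i)^n` for a natural exponent is the honest power. [cite: NeukirchSchmidtWingberg2008, (5.3.5)] -/
theorem onePlusXPow_natCast (i : Fin 2) (n : ℕ) :
    onePlusXPow 𝒪 i (n : ℤ_[p]) = (1 + MvPowerSeries.X i) ^ n := by
  rw [onePlusXPow, PowerSeries.binomialSeries_nat, map_pow, map_add, map_one,
    PowerSeries.toMvPowerSeries_X]

/-- `(1+T_i)^1 = 1 + T_i`. [cite: NeukirchSchmidtWingberg2008, (5.3.5)] -/
@[simp] theorem onePlusXPow_one (i : Fin 2) : onePlusXPow 𝒪 i (1 : ℤ_[p]) = 1 + MvPowerSeries.X i := by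
  simpa using onePlusXPow_natCast 𝒪 i 1

/-- `(1+T_i)^{x·n} = ((1+T_i)^x)^n` for `n ∈ ℕ`. [cite: NeukirchSchmidtWingberg2008, (5.3.5)] -/
theorem onePlusXPow_mul_natCast (i : Fin 2) (x : ℤ_[p]) (n : ℕ) :
    onePlusXPow 𝒪 i (x * (n : ℤ_[p])) = onePlusXPow 𝒪 i x ^ n := by
  induction n with
  | zero => rw [Nat.cast_zero, mul_zero, onePlusXPow_zero, pow_zero]
  | succ n ih => rw [Nat.cast_succ, mul_add, mul_one, onePlusXPow_add, ih, pow_succ]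

/-- `(1+T_i)^{−x} (1+T_i)^x = 1`. [cite: NeukirchSchmidtWingberg2008, (5.3.5)] -/
theorem onePlusXPow_neg_mul_self (i : Fin 2) (x : ℤ_[p]) :
    onePlusXPow 𝒪 i (-x) * onePlusXPow 𝒪 i x = 1 := by
  rw [← onePlusXPow_add, neg_add_cancel, onePlusXPow_zero]

/-- `(1+T_i)^x` is a unit. [cite: NeukirchSchmidtWingberg2008, (5.3.5)] -/
theorem isUnit_onePlusXPow (i : Fin 2) (x : ℤ_[p]) : IsUnit (onePlusXPow 𝒪 i x) :=
  IsUnit.of_mul_eq_one_right _ (onePlusXPow_neg_mul_self 𝒪 i x)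

/-- Coefficients of `(1+T_i)^x`: `(x choose n)` on `T_iⁿ`, zero off the `i`-axis.
[cite: NeukirchSchmidtWingberg2008, (5.3.5)] -/
theorem coeff_onePlusXPow (i : Fin 2) (x : ℤ_[p]) (e : Fin 2 →₀ ℕ) :
    MvPowerSeries.coeff e (onePlusXPow 𝒪 i x) =
      if e = Finsupp.single i (e i) then Ring.choose x (e i) • (1 : 𝒪) else 0 := by
  rw [onePlusXPow, coeff_toMvPowerSeries, PowerSeries.binomialSeries_coeff]

/-- `(1+T_i)^x` has constant term `1`. [cite: NeukirchSchmidtWingberg2008, (5.3.5)] -/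
@[simp] theorem constantCoeff_onePlusXPow (i : Fin 2) (x : ℤ_[p]) :
    MvPowerSeries.constantCoeff (onePlusXPow 𝒪 i x) = 1 := by
  rw [← MvPowerSeries.coeff_zero_eq_constantCoeff_apply, coeff_onePlusXPow, if_pos]
  · rw [Finsupp.coe_zero, Pi.zero_apply, Ring.choose_zero_right, one_smul]
  · rw [Finsupp.coe_zero, Pi.zero_apply, Finsupp.single_zero]

/-- The binomial series with `p`-adic exponent over `𝒪` is the base change of the one over `ℤ_p`.
[cite: NeukirchSchmidtWingberg2008, (5.3.5)] -/
theorem map_binomialSeries (x : ℤ_[p]) :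
    PowerSeries.map (algebraMap ℤ_[p] 𝒪) (PowerSeries.binomialSeries ℤ_[p] x) =
      PowerSeries.binomialSeries 𝒪 x := by
  ext n
  rw [PowerSeries.coeff_map, PowerSeries.binomialSeries_coeff, PowerSeries.binomialSeries_coeff,
    smul_eq_mul, mul_one, Algebra.algebraMap_eq_smul_one]

/-- `(1+T_i)^x` over `𝒪` is the base change of `(1+T_i)^x` over `ℤ_p`. [cite: NeukirchSchmidtWingberg2008, (5.3.5)] -/
theorem map_onePlusXPow (i : Fin 2) (x : ℤ_[p]) :
    MvPowerSeries.map (algebraMap ℤ_[p] 𝒪) (onePlusXPow ℤ_[p] i x) = onePlusXPow 𝒪 i x := by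
  classical
  ext e
  rw [MvPowerSeries.coeff_map, coeff_onePlusXPow, coeff_onePlusXPow]
  split_ifs
  · rw [smul_eq_mul, mul_one, Algebra.algebraMap_eq_smul_one]
  · rw [map_zero]

/-! ## §2 `((1+T₁)^{y₀} (1+T₂)^{y₁})^x = (1+T₁)^{y₀ x} (1+T₂)^{y₁ x}` -/

/-- The coefficients of `(1+T_i)^{y z}` are continuous in the `p`-adic variable `z` (Mahler:
`z ↦ (z choose n)` is continuous; private helper). [folklore] -/
private theorem continuous_coeff_onePlusXPow (i : Fin 2) (y : ℤ_[p]) (e : Fin 2 →₀ ℕ) :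
    Continuous fun z : ℤ_[p] ↦ MvPowerSeries.coeff e (onePlusXPow ℤ_[p] i (y * z)) := by
  classical
  by_cases he : e = Finsupp.single i (e i)
  · simp_rw [coeff_onePlusXPow, if_pos he, smul_eq_mul, mul_one]
    exact (PadicInt.continuous_choose _).comp (continuous_const.mul continuous_id)
  · simp_rw [coeff_onePlusXPow, if_neg he]
    exact continuous_const

/-- **`((1+T₁)^{y₀} (1+T₂)^{y₁})^x = (1+T₁)^{y₀x} (1+T₂)^{y₁x}` over `ℤ_p`**: substituting
`T ↦ (1+T₁)^{y₀}(1+T₂)^{y₁} − 1` into `(1+T)^x` gives `(1+T₁)^{y₀x}(1+T₂)^{y₁x}`. Both sides have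
coefficients continuous in `x` (finite sums of binomial coefficients) and agree for `x ∈ ℕ` (dense
in `ℤ_p`), where it is `(uv)^m = u^m v^m`. [cite: NeukirchSchmidtWingberg2008, (5.3.5)]
[cite: Washington1997, §13.2] -/
theorem subst_binomialSeries_eq_int (y₀ y₁ x : ℤ_[p]) :
    PowerSeries.subst (onePlusXPow ℤ_[p] 0 y₀ * onePlusXPow ℤ_[p] 1 y₁ - 1)
        (PowerSeries.binomialSeries ℤ_[p] x) =
      onePlusXPow ℤ_[p] 0 (y₀ * x) * onePlusXPow ℤ_[p] 1 (y₁ * x) := by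
  set ω : MvPowerSeries (Fin 2) ℤ_[p] := onePlusXPow ℤ_[p] 0 y₀ * onePlusXPow ℤ_[p] 1 y₁ - 1
    with hωdef
  have hω : MvPowerSeries.constantCoeff ω = 0 := by
    rw [hωdef, map_sub, map_mul, constantCoeff_onePlusXPow, constantCoeff_onePlusXPow, map_one,
      mul_one, sub_self]
  have hωs : PowerSeries.HasSubst ω := PowerSeries.HasSubst.of_constantCoeff_zero hω
  ext e
  suffices h : (fun z : ℤ_[p] ↦
      MvPowerSeries.coeff e (PowerSeries.subst ω (PowerSeries.binomialSeries ℤ_[p] z))) =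
      fun z ↦ MvPowerSeries.coeff e (onePlusXPow ℤ_[p] 0 (y₀ * z) * onePlusXPow ℤ_[p] 1 (y₁ * z)) from
    congrFun h x
  apply Continuous.ext_on PadicInt.denseRange_natCast
  · have hform : (fun z : ℤ_[p] ↦
        MvPowerSeries.coeff e (PowerSeries.subst ω (PowerSeries.binomialSeries ℤ_[p] z))) =
        fun z ↦ ∑ n ∈ Finset.range (e.degree + 1), Ring.choose z n * MvPowerSeries.coeff e (ω ^ n) := by
      funext z
      rw [coeff_subst_eq_sum_of_constantCoeff_eq_zero hω]
      simp only [PowerSeries.binomialSeries_coeff, smul_eq_mul, mul_one]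
    rw [hform]
    exact continuous_finsetSum _ fun n _ ↦ (PadicInt.continuous_choose n).mul continuous_const
  · simp_rw [MvPowerSeries.coeff_mul]
    exact continuous_finsetSum _ fun uv _ ↦
      (continuous_coeff_onePlusXPow 0 y₀ uv.1).mul (continuous_coeff_onePlusXPow 1 y₁ uv.2)
  · rintro _ ⟨m, rfl⟩
    have hone : PowerSeries.subst ω (1 : PowerSeries ℤ_[p]) = 1 := by
      rw [← PowerSeries.coe_substAlgHom hωs, map_one]
    simp only
    rw [PowerSeries.binomialSeries_nat, PowerSeries.subst_pow hωs, PowerSeries.subst_add hωs, hone,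
      PowerSeries.subst_X hωs, onePlusXPow_mul_natCast, onePlusXPow_mul_natCast, ← mul_pow, hωdef,
      add_sub_cancel]

/-- **`((1+T₁)^{y₀} (1+T₂)^{y₁})^x = (1+T₁)^{y₀x} (1+T₂)^{y₁x}` over any `ℤ_p`-algebra `𝒪`** (base
change of `subst_binomialSeries_eq_int` along `ℤ_p → 𝒪`). [cite: NeukirchSchmidtWingberg2008, (5.3.5)] -/
theorem subst_binomialSeries_eq (y₀ y₁ x : ℤ_[p]) :
    PowerSeries.subst (onePlusXPow 𝒪 0 y₀ * onePlusXPow 𝒪 1 y₁ - 1) (PowerSeries.binomialSeries 𝒪 x) =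
      onePlusXPow 𝒪 0 (y₀ * x) * onePlusXPow 𝒪 1 (y₁ * x) := by
  have hω : MvPowerSeries.constantCoeff (onePlusXPow ℤ_[p] 0 y₀ * onePlusXPow ℤ_[p] 1 y₁ - 1) = 0 := by
    rw [map_sub, map_mul, constantCoeff_onePlusXPow, constantCoeff_onePlusXPow, map_one, mul_one,
      sub_self]
  have h := congrArg (MvPowerSeries.map (algebraMap ℤ_[p] 𝒪)) (subst_binomialSeries_eq_int y₀ y₁ x)
  rw [PowerSeries.map_subst (PowerSeries.HasSubst.of_constantCoeff_zero hω), map_mul, map_onePlusXPow,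
    map_onePlusXPow, map_sub, map_mul, map_one, map_onePlusXPow, map_onePlusXPow,
    map_binomialSeries] at h
  exact h

/-! ## §3 Frames: the substitution `T_j ↦ (1+T₁)^{A 0 j} (1+T₂)^{A 1 j} − 1` of `𝒪⟦T₁, T₂⟧` -/

variable (A : Matrix (Fin 2) (Fin 2) ℤ_[p])

/-- **The frame monomial `(1+T₁)^{A 0 j} (1+T₂)^{A 1 j}`** — the image of `1 + T_j` under the frame
substitution of `A = (a b; c d)`: column `j` of `A` lists the exponents (`j = 0`: `(1+T₁)^a (1+T₂)^c`;
`j = 1`: `(1+T₁)^b (1+T₂)^d`). [cite: NeukirchSchmidtWingberg2008, (5.3.5)] -/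
def frameMonomial (j : Fin 2) : MvPowerSeries (Fin 2) 𝒪 :=
  onePlusXPow 𝒪 0 (A 0 j) * onePlusXPow 𝒪 1 (A 1 j)

/-- **The frame images `(1+T₁)^{A 0 j} (1+T₂)^{A 1 j} − 1`** — the images of the variables `T_j`.
[cite: NeukirchSchmidtWingberg2008, (5.3.5)] -/
def frameImages (j : Fin 2) : MvPowerSeries (Fin 2) 𝒪 := frameMonomial 𝒪 A j - 1

/-- Unfolding `frameMonomial`. [cite: NeukirchSchmidtWingberg2008, (5.3.5)] -/
theorem frameMonomial_def (j : Fin 2) :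
    frameMonomial 𝒪 A j = onePlusXPow 𝒪 0 (A 0 j) * onePlusXPow 𝒪 1 (A 1 j) := rfl

/-- Unfolding `frameImages`. [cite: NeukirchSchmidtWingberg2008, (5.3.5)] -/
theorem frameImages_def (j : Fin 2) : frameImages 𝒪 A j = frameMonomial 𝒪 A j - 1 := rfl

/-- Frame monomials have constant term `1`. [cite: NeukirchSchmidtWingberg2008, (5.3.5)] -/
@[simp] theorem constantCoeff_frameMonomial (j : Fin 2) :
    MvPowerSeries.constantCoeff (frameMonomial 𝒪 A j) = 1 := by
  rw [frameMonomial, map_mul, constantCoeff_onePlusXPow, constantCoeff_onePlusXPow, mul_one]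

/-- Frame images have constant term `0`. [cite: NeukirchSchmidtWingberg2008, (5.3.5)] -/
@[simp] theorem constantCoeff_frameImages (j : Fin 2) :
    MvPowerSeries.constantCoeff (frameImages 𝒪 A j) = 0 := by
  rw [frameImages, map_sub, constantCoeff_frameMonomial, map_one, sub_self]

/-- Frame images are substitutable. [cite: NeukirchSchmidtWingberg2008, (5.3.5)] -/
theorem hasSubst_frameImages : MvPowerSeries.HasSubst (frameImages 𝒪 A) :=
  MvPowerSeries.hasSubst_of_constantCoeff_zero fun j ↦ constantCoeff_frameImages 𝒪 A j

/-- **The frame substitution on `𝒪⟦T₁, T₂⟧`** (`MvPowerSeries (Fin 2) 𝒪`): the `𝒪`-algebra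
endomorphism `f ↦ f(T_j ↦ (1+T₁)^{A 0 j} (1+T₂)^{A 1 j} − 1)` (Mathlib `MvPowerSeries.substAlgHom`).
[cite: NeukirchSchmidtWingberg2008, (5.3.5)] -/
def frameSubstMv : MvPowerSeries (Fin 2) 𝒪 →ₐ[𝒪] MvPowerSeries (Fin 2) 𝒪 :=
  MvPowerSeries.substAlgHom (hasSubst_frameImages 𝒪 A)

/-- Unfolding: `frameSubstMv A f = f.subst (frameImages A)`. [cite: NeukirchSchmidtWingberg2008, (5.3.5)] -/
theorem frameSubstMv_apply (f : MvPowerSeries (Fin 2) 𝒪) :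
    frameSubstMv 𝒪 A f = MvPowerSeries.subst (frameImages 𝒪 A) f := by
  rw [frameSubstMv, MvPowerSeries.coe_substAlgHom]

/-- `T_j ↦ (1+T₁)^{A 0 j} (1+T₂)^{A 1 j} − 1`. [cite: NeukirchSchmidtWingberg2008, (5.3.5)] -/
theorem frameSubstMv_X (j : Fin 2) : frameSubstMv 𝒪 A (MvPowerSeries.X j) = frameImages 𝒪 A j := by
  rw [frameSubstMv_apply, MvPowerSeries.subst_X (hasSubst_frameImages 𝒪 A)]

/-- `1 + T_j ↦ (1+T₁)^{A 0 j} (1+T₂)^{A 1 j}`. [cite: NeukirchSchmidtWingberg2008, (5.3.5)] -/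
theorem frameSubstMv_one_add_X (j : Fin 2) :
    frameSubstMv 𝒪 A (1 + MvPowerSeries.X j) = frameMonomial 𝒪 A j := by
  rw [map_add, map_one, frameSubstMv_X, frameImages, add_sub_cancel]

/-- The frame substitution fixes constants. [cite: NeukirchSchmidtWingberg2008, (5.3.5)] -/
theorem frameSubstMv_C (r : 𝒪) : frameSubstMv 𝒪 A (MvPowerSeries.C r) = MvPowerSeries.C r :=
  (frameSubstMv 𝒪 A).commutes r

/-- **`(1+T_i)^x ↦ (1+T₁)^{A 0 i · x} (1+T₂)^{A 1 i · x}`** (`γ_i^x ↦ (γ₁^{a_{0i}} γ₂^{a_{1i}})^x`).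
[cite: NeukirchSchmidtWingberg2008, (5.3.5)] -/
theorem frameSubstMv_onePlusXPow (i : Fin 2) (x : ℤ_[p]) :
    frameSubstMv 𝒪 A (onePlusXPow 𝒪 i x) =
      onePlusXPow 𝒪 0 (A 0 i * x) * onePlusXPow 𝒪 1 (A 1 i * x) := by
  rw [frameSubstMv_apply, onePlusXPow, PowerSeries.subst_toMvPowerSeries (hasSubst_frameImages 𝒪 A),
    frameImages, frameMonomial, subst_binomialSeries_eq]

/-- The frame substitution of `A` maps the frame monomials of `B` to those of `A * B`.
[cite: NeukirchSchmidtWingberg2008, (5.3.5)] -/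
theorem frameSubstMv_frameMonomial (B : Matrix (Fin 2) (Fin 2) ℤ_[p]) (j : Fin 2) :
    frameSubstMv 𝒪 A (frameMonomial 𝒪 B j) = frameMonomial 𝒪 (A * B) j := by
  rw [frameMonomial, map_mul, frameSubstMv_onePlusXPow, frameSubstMv_onePlusXPow, frameMonomial,
    Matrix.mul_apply, Matrix.mul_apply, Fin.sum_univ_two, Fin.sum_univ_two, onePlusXPow_add,
    onePlusXPow_add]
  ring

/-- The frame substitution of `A` maps the frame images of `B` to those of `A * B`.
[cite: NeukirchSchmidtWingberg2008, (5.3.5)] -/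
theorem frameSubstMv_frameImages (B : Matrix (Fin 2) (Fin 2) ℤ_[p]) (j : Fin 2) :
    frameSubstMv 𝒪 A (frameImages 𝒪 B j) = frameImages 𝒪 (A * B) j := by
  rw [frameImages, map_sub, map_one, frameSubstMv_frameMonomial, frameImages]

/-- **Composition law `φ_A ∘ φ_B = φ_{AB}`** on `𝒪⟦T₁, T₂⟧`. [cite: NeukirchSchmidtWingberg2008, (5.3.5)] -/
theorem frameSubstMv_frameSubstMv (B : Matrix (Fin 2) (Fin 2) ℤ_[p]) (f : MvPowerSeries (Fin 2) 𝒪) :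
    frameSubstMv 𝒪 A (frameSubstMv 𝒪 B f) = frameSubstMv 𝒪 (A * B) f := by
  rw [frameSubstMv_apply, frameSubstMv_apply, frameSubstMv_apply,
    MvPowerSeries.subst_comp_subst_apply (hasSubst_frameImages 𝒪 B) (hasSubst_frameImages 𝒪 A)]
  congr 1
  funext j
  rw [← frameSubstMv_apply, frameSubstMv_frameImages]

/-- The identity frame has images `T_j`. [cite: NeukirchSchmidtWingberg2008, (5.3.5)] -/
theorem frameImages_one (j : Fin 2) : frameImages 𝒪 (1 : Matrix (Fin 2) (Fin 2) ℤ_[p]) j = MvPowerSeries.X j := by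
  fin_cases j <;>
    simp [frameImages, frameMonomial, Matrix.one_apply]

/-- **`φ_1 = id`**. [cite: NeukirchSchmidtWingberg2008, (5.3.5)] -/
theorem frameSubstMv_one (f : MvPowerSeries (Fin 2) 𝒪) :
    frameSubstMv 𝒪 (1 : Matrix (Fin 2) (Fin 2) ℤ_[p]) f = f := by
  rw [frameSubstMv_apply, show frameImages 𝒪 (1 : Matrix (Fin 2) (Fin 2) ℤ_[p]) = MvPowerSeries.X from
    funext (frameImages_one 𝒪), ← MvPowerSeries.map_algebraMap_eq_subst_X, Algebra.algebraMap_self,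
    MvPowerSeries.map_id, RingHom.id_apply]

/-! ## §4 The nested ring `Λ₂(𝒪) = 𝒪⟦T₂⟧⟦T₁⟧ = PowerSeries (PowerSeries 𝒪)`: dictionary and transport -/

section Nested

variable {𝒪}

/-- An exponent vector `e` on `Fin 2` is supported on `{0}` iff `e 1 = 0`. [folklore] -/
private theorem eq_single_zero_iff (e : Fin 2 →₀ ℕ) : e = Finsupp.single 0 (e 0) ↔ e 1 = 0 := by
  constructor
  · intro h
    rw [h, Finsupp.single_apply, if_neg Fin.zero_ne_one]
  · intro h
    ext s
    fin_cases s
    · simp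
    · simpa using h

/-- An exponent vector `e` on `Fin 2` is supported on `{1}` iff `e 0 = 0`. [folklore] -/
private theorem eq_single_one_iff (e : Fin 2 →₀ ℕ) : e = Finsupp.single 1 (e 1) ↔ e 0 = 0 := by
  constructor
  · intro h
    rw [h, Finsupp.single_apply, if_neg (Ne.symm Fin.zero_ne_one)]
  · intro h
    ext s
    fin_cases s
    · simpa using h
    · simp

variable (𝒪)

/-- **Dictionary, outer variable**: a series in `T₁` with constant inner coefficients,
`Σₙ C(fₙ) T₁ⁿ = PowerSeries.map C f`, goes to `f(X₀)` under `𝒪⟦T₂⟧⟦T₁⟧ ≃ 𝒪⟦T₁, T₂⟧`.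
[cite: NeukirchSchmidtWingberg2008, (5.3.5)] -/
theorem nestedPowerSeriesEquiv_map_C (f : PowerSeries 𝒪) :
    nestedPowerSeriesEquiv (PowerSeries.map (PowerSeries.C (R := 𝒪)) f) =
      PowerSeries.toMvPowerSeries 0 f := by
  classical
  ext e
  rw [coeff_nestedPowerSeriesEquiv, PowerSeries.coeff_map, PowerSeries.coeff_C, coeff_toMvPowerSeries]
  by_cases h : e 1 = 0
  · rw [if_pos h, if_pos ((eq_single_zero_iff e).mpr h)]
  · rw [if_neg h, if_neg (fun h' ↦ h ((eq_single_zero_iff e).mp h'))]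

/-- **Dictionary, inner variable**: an inner series as an outer constant, `C g`, goes to `g(X₁)`.
[cite: NeukirchSchmidtWingberg2008, (5.3.5)] -/
theorem nestedPowerSeriesEquiv_C (g : PowerSeries 𝒪) :
    nestedPowerSeriesEquiv (PowerSeries.C g) = PowerSeries.toMvPowerSeries 1 g := by
  classical
  ext e
  rw [coeff_nestedPowerSeriesEquiv, PowerSeries.coeff_C, coeff_toMvPowerSeries]
  by_cases h : e 0 = 0
  · rw [if_pos h, if_pos ((eq_single_one_iff e).mpr h)]
  · rw [if_neg h, map_zero, if_neg (fun h' ↦ h ((eq_single_one_iff e).mp h'))]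

/-- `(1+T₁)^x` in the nested ring, `PowerSeries.map C (binomialSeries 𝒪 x)`, goes to `onePlusXPow 0 x`.
[cite: NeukirchSchmidtWingberg2008, (5.3.5)] -/
theorem nestedPowerSeriesEquiv_onePlusT₁Pow (x : ℤ_[p]) :
    nestedPowerSeriesEquiv (PowerSeries.map (PowerSeries.C (R := 𝒪)) (PowerSeries.binomialSeries 𝒪 x)) =
      onePlusXPow 𝒪 0 x :=
  nestedPowerSeriesEquiv_map_C 𝒪 _

/-- `(1+T₂)^x` in the nested ring, `C (binomialSeries 𝒪 x)`, goes to `onePlusXPow 1 x`.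
[cite: NeukirchSchmidtWingberg2008, (5.3.5)] -/
theorem nestedPowerSeriesEquiv_onePlusT₂Pow (x : ℤ_[p]) :
    nestedPowerSeriesEquiv (PowerSeries.C (PowerSeries.binomialSeries 𝒪 x)) = onePlusXPow 𝒪 1 x :=
  nestedPowerSeriesEquiv_C 𝒪 _

/-- **The frame substitution of `Λ₂(𝒪) = 𝒪⟦T₂⟧⟦T₁⟧` as a ring endomorphism** (any matrix `A`):
`frameSubstMv A` transported along `nestedPowerSeriesEquiv : 𝒪⟦T₂⟧⟦T₁⟧ ≃+* 𝒪⟦T₁, T₂⟧`.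
[cite: NeukirchSchmidtWingberg2008, (5.3.5)] -/
def frameSubstRingHom : PowerSeries (PowerSeries 𝒪) →+* PowerSeries (PowerSeries 𝒪) :=
  (nestedPowerSeriesEquiv (R := 𝒪)).symm.toRingHom.comp
    ((frameSubstMv 𝒪 A).toRingHom.comp (nestedPowerSeriesEquiv (R := 𝒪)).toRingHom)

/-- Unfolding `frameSubstRingHom`. [cite: NeukirchSchmidtWingberg2008, (5.3.5)] -/
theorem frameSubstRingHom_apply (F : PowerSeries (PowerSeries 𝒪)) :
    frameSubstRingHom 𝒪 A F =
      (nestedPowerSeriesEquiv (R := 𝒪)).symm (frameSubstMv 𝒪 A (nestedPowerSeriesEquiv F)) := rfl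

/-- Composition law `φ_A ∘ φ_B = φ_{AB}` on the nested ring. [cite: NeukirchSchmidtWingberg2008, (5.3.5)] -/
theorem frameSubstRingHom_frameSubstRingHom (B : Matrix (Fin 2) (Fin 2) ℤ_[p])
    (F : PowerSeries (PowerSeries 𝒪)) :
    frameSubstRingHom 𝒪 A (frameSubstRingHom 𝒪 B F) = frameSubstRingHom 𝒪 (A * B) F := by
  simp only [frameSubstRingHom_apply, RingEquiv.apply_symm_apply, frameSubstMv_frameSubstMv]

/-- `φ_1 = id` on the nested ring. [cite: NeukirchSchmidtWingberg2008, (5.3.5)] -/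
theorem frameSubstRingHom_one (F : PowerSeries (PowerSeries 𝒪)) :
    frameSubstRingHom 𝒪 (1 : Matrix (Fin 2) (Fin 2) ℤ_[p]) F = F := by
  rw [frameSubstRingHom_apply, frameSubstMv_one, RingEquiv.symm_apply_apply]

/-- `frameSubstRingHom` fixes the constants `C (C r)`. [cite: NeukirchSchmidtWingberg2008, (5.3.5)] -/
theorem frameSubstRingHom_C_C (r : 𝒪) :
    frameSubstRingHom 𝒪 A (PowerSeries.C (PowerSeries.C r)) = PowerSeries.C (PowerSeries.C r) := by
  rw [frameSubstRingHom_apply, nestedPowerSeriesEquiv_C_C, frameSubstMv_C, ← nestedPowerSeriesEquiv_C_C,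
    RingEquiv.symm_apply_apply]

/-- `frameSubstRingHom A` on `(1+T₁)^x`: `↦ (1+T₁)^{A 0 0 · x} (1+T₂)^{A 1 0 · x}`.
[cite: NeukirchSchmidtWingberg2008, (5.3.5)] -/
theorem frameSubstRingHom_onePlusT₁Pow (x : ℤ_[p]) :
    frameSubstRingHom 𝒪 A (PowerSeries.map (PowerSeries.C (R := 𝒪)) (PowerSeries.binomialSeries 𝒪 x)) =
      PowerSeries.map (PowerSeries.C (R := 𝒪)) (PowerSeries.binomialSeries 𝒪 (A 0 0 * x)) *
        PowerSeries.C (PowerSeries.binomialSeries 𝒪 (A 1 0 * x)) := by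
  rw [frameSubstRingHom_apply, nestedPowerSeriesEquiv_onePlusT₁Pow, frameSubstMv_onePlusXPow,
    ← nestedPowerSeriesEquiv_onePlusT₁Pow, ← nestedPowerSeriesEquiv_onePlusT₂Pow, ← map_mul,
    RingEquiv.symm_apply_apply]

/-- `frameSubstRingHom A` on `(1+T₂)^x`: `↦ (1+T₁)^{A 0 1 · x} (1+T₂)^{A 1 1 · x}`.
[cite: NeukirchSchmidtWingberg2008, (5.3.5)] -/
theorem frameSubstRingHom_onePlusT₂Pow (x : ℤ_[p]) :
    frameSubstRingHom 𝒪 A (PowerSeries.C (PowerSeries.binomialSeries 𝒪 x)) =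
      PowerSeries.map (PowerSeries.C (R := 𝒪)) (PowerSeries.binomialSeries 𝒪 (A 0 1 * x)) *
        PowerSeries.C (PowerSeries.binomialSeries 𝒪 (A 1 1 * x)) := by
  rw [frameSubstRingHom_apply, nestedPowerSeriesEquiv_onePlusT₂Pow, frameSubstMv_onePlusXPow,
    ← nestedPowerSeriesEquiv_onePlusT₁Pow, ← nestedPowerSeriesEquiv_onePlusT₂Pow, ← map_mul,
    RingEquiv.symm_apply_apply]

/-- `(1+T₁)^1 = 1 + T₁` in the nested ring. [cite: NeukirchSchmidtWingberg2008, (5.3.5)] -/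
theorem map_C_binomialSeries_one :
    PowerSeries.map (PowerSeries.C (R := 𝒪)) (PowerSeries.binomialSeries 𝒪 (1 : ℤ_[p])) =
      1 + PowerSeries.X := by
  rw [show (1 : ℤ_[p]) = ((1 : ℕ) : ℤ_[p]) by rw [Nat.cast_one], PowerSeries.binomialSeries_nat, pow_one,
    map_add, map_one, PowerSeries.map_X]

/-- `(1+T₂)^1 = 1 + T₂` in the nested ring. [cite: NeukirchSchmidtWingberg2008, (5.3.5)] -/
theorem C_binomialSeries_one :
    PowerSeries.C (PowerSeries.binomialSeries 𝒪 (1 : ℤ_[p])) =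
      1 + PowerSeries.C (PowerSeries.X : PowerSeries 𝒪) := by
  rw [show (1 : ℤ_[p]) = ((1 : ℕ) : ℤ_[p]) by rw [Nat.cast_one], PowerSeries.binomialSeries_nat, pow_one,
    map_add, map_one]

/-- **`1 + T₁ ↦ (1+T₁)^a (1+T₂)^c`** (`a = A 0 0`, `c = A 1 0`). [cite: NeukirchSchmidtWingberg2008, (5.3.5)] -/
theorem frameSubstRingHom_one_add_X :
    frameSubstRingHom 𝒪 A (1 + PowerSeries.X) =
      PowerSeries.map (PowerSeries.C (R := 𝒪)) (PowerSeries.binomialSeries 𝒪 (A 0 0)) *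
        PowerSeries.C (PowerSeries.binomialSeries 𝒪 (A 1 0)) := by
  rw [← map_C_binomialSeries_one 𝒪 (p := p), frameSubstRingHom_onePlusT₁Pow, mul_one, mul_one]

/-- **`1 + T₂ ↦ (1+T₁)^b (1+T₂)^d`** (`b = A 0 1`, `d = A 1 1`). [cite: NeukirchSchmidtWingberg2008, (5.3.5)] -/
theorem frameSubstRingHom_one_add_C_X :
    frameSubstRingHom 𝒪 A (1 + PowerSeries.C PowerSeries.X) =
      PowerSeries.map (PowerSeries.C (R := 𝒪)) (PowerSeries.binomialSeries 𝒪 (A 0 1)) *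
        PowerSeries.C (PowerSeries.binomialSeries 𝒪 (A 1 1)) := by
  rw [← C_binomialSeries_one 𝒪 (p := p), frameSubstRingHom_onePlusT₂Pow, mul_one, mul_one]

end Nested

/-! ## §5 `frameSubst A : Λ₂(𝒪) ≃+* Λ₂(𝒪)` for `A ∈ GL₂(ℤ_p)` -/

section Equiv

/-- **The frame substitution `φ_A : Λ₂(𝒪) ≃+* Λ₂(𝒪)` of `A = (a b; c d) ∈ GL₂(ℤ_p)`** on
`Λ₂(𝒪) = 𝒪⟦T₂⟧⟦T₁⟧ = PowerSeries (PowerSeries 𝒪)` (outer `T₁ = X`, inner `T₂ = C X`): the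
ring automorphism (substitution) with `1 + T₁ ↦ (1+T₁)^a (1+T₂)^c`, `1 + T₂ ↦ (1+T₁)^b (1+T₂)^d`
(`(1+T)^x` the binomial series), fixing constants, inverse `φ_{A⁻¹}` (it is the continuous `𝒪`-algebra
automorphism with these values; continuity is not recorded here). Under `𝒪⟦ℤ_p γ₁ ⊕ ℤ_p γ₂⟧ ≅ 𝒪⟦T₁, T₂⟧`,
`γ_i ↦ 1 + T_i`, it is the automorphism induced by the change of topological basis
`γ₁ ↦ γ₁^a γ₂^c`, `γ₂ ↦ γ₁^b γ₂^d` — the rank-two analogue of `GeneratorChange.substEquiv`.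
[cite: NeukirchSchmidtWingberg2008, (5.3.5)] [cite: Lang1990, Ch. 5 §1, Thm. 1.1 (PDF p. 94)]
[cite: Washington1997, §13.2] -/
def frameSubst (A : GL (Fin 2) ℤ_[p]) : PowerSeries (PowerSeries 𝒪) ≃+* PowerSeries (PowerSeries 𝒪) where
  toFun := frameSubstRingHom 𝒪 (A : Matrix (Fin 2) (Fin 2) ℤ_[p])
  invFun := frameSubstRingHom 𝒪 ((A⁻¹ : GL (Fin 2) ℤ_[p]) : Matrix (Fin 2) (Fin 2) ℤ_[p])
  left_inv F := by
    rw [frameSubstRingHom_frameSubstRingHom, Units.inv_mul, frameSubstRingHom_one]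
  right_inv F := by
    rw [frameSubstRingHom_frameSubstRingHom, Units.mul_inv, frameSubstRingHom_one]
  map_mul' F G := map_mul _ F G
  map_add' F G := map_add _ F G

variable (A' : GL (Fin 2) ℤ_[p])

/-- Unfolding `frameSubst`. [cite: NeukirchSchmidtWingberg2008, (5.3.5)] -/
@[simp] theorem frameSubst_apply (F : PowerSeries (PowerSeries 𝒪)) :
    frameSubst 𝒪 A' F = frameSubstRingHom 𝒪 (A' : Matrix (Fin 2) (Fin 2) ℤ_[p]) F := rfl

/-- **Inverse: `(φ_A)⁻¹ = φ_{A⁻¹}`.** [cite: NeukirchSchmidtWingberg2008, (5.3.5)] -/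
theorem frameSubst_symm : (frameSubst 𝒪 A').symm = frameSubst 𝒪 A'⁻¹ :=
  RingEquiv.ext fun _ ↦ rfl

/-- Unfolding the inverse. [cite: NeukirchSchmidtWingberg2008, (5.3.5)] -/
@[simp] theorem frameSubst_symm_apply (F : PowerSeries (PowerSeries 𝒪)) :
    (frameSubst 𝒪 A').symm F = frameSubstRingHom 𝒪 ((A'⁻¹ : GL (Fin 2) ℤ_[p]) : Matrix (Fin 2) (Fin 2) ℤ_[p]) F :=
  rfl

/-- **`φ_1 = id`.** [cite: NeukirchSchmidtWingberg2008, (5.3.5)] -/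
theorem frameSubst_one : frameSubst 𝒪 (1 : GL (Fin 2) ℤ_[p]) = RingEquiv.refl _ :=
  RingEquiv.ext fun F ↦ by rw [frameSubst_apply, Units.val_one, frameSubstRingHom_one]; rfl

/-- **Composition law (ORDER): `φ_{AB} = φ_A ∘ φ_B`**, i.e. `frameSubst (A * B) F = frameSubst A (frameSubst B F)`
— `A ↦ φ_A` is a homomorphism `GL₂(ℤ_p) → Aut Λ₂(𝒪)` for composition of maps.
[cite: NeukirchSchmidtWingberg2008, (5.3.5)] -/
theorem frameSubst_mul (B' : GL (Fin 2) ℤ_[p]) (F : PowerSeries (PowerSeries 𝒪)) :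
    frameSubst 𝒪 (A' * B') F = frameSubst 𝒪 A' (frameSubst 𝒪 B' F) := by
  rw [frameSubst_apply, frameSubst_apply, frameSubst_apply, Units.val_mul,
    frameSubstRingHom_frameSubstRingHom]

/-- The same as an identity of ring automorphisms: `frameSubst (A * B) = (frameSubst B).trans (frameSubst A)`.
[cite: NeukirchSchmidtWingberg2008, (5.3.5)] -/
theorem frameSubst_mul_eq_trans (B' : GL (Fin 2) ℤ_[p]) :
    frameSubst 𝒪 (A' * B') = (frameSubst 𝒪 B').trans (frameSubst 𝒪 A') :=
  RingEquiv.ext fun F ↦ frameSubst_mul 𝒪 A' B' F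

/-- **(1) `φ_A` fixes constants**: `frameSubst A (C (C r)) = C (C r)` (the route's `const 𝒪 r`).
[cite: NeukirchSchmidtWingberg2008, (5.3.5)] -/
@[simp] theorem frameSubst_C_C (r : 𝒪) :
    frameSubst 𝒪 A' (PowerSeries.C (PowerSeries.C r)) = PowerSeries.C (PowerSeries.C r) :=
  frameSubstRingHom_C_C 𝒪 _ r

/-- **(3) `φ_A (1 + T₁) = (1+T₁)^a (1+T₂)^c`**, `(1+T₁)^x = PowerSeries.map C (binomialSeries 𝒪 x)`,
`(1+T₂)^y = C (binomialSeries 𝒪 y)`. [cite: NeukirchSchmidtWingberg2008, (5.3.5)] -/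
theorem frameSubst_one_add_X :
    frameSubst 𝒪 A' (1 + PowerSeries.X) =
      PowerSeries.map (PowerSeries.C (R := 𝒪)) (PowerSeries.binomialSeries 𝒪 (A' 0 0)) *
        PowerSeries.C (PowerSeries.binomialSeries 𝒪 (A' 1 0)) :=
  frameSubstRingHom_one_add_X 𝒪 _

/-- **(3) `φ_A (1 + T₂) = (1+T₁)^b (1+T₂)^d`.** [cite: NeukirchSchmidtWingberg2008, (5.3.5)] -/
theorem frameSubst_one_add_C_X :
    frameSubst 𝒪 A' (1 + PowerSeries.C PowerSeries.X) =
      PowerSeries.map (PowerSeries.C (R := 𝒪)) (PowerSeries.binomialSeries 𝒪 (A' 0 1)) *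
        PowerSeries.C (PowerSeries.binomialSeries 𝒪 (A' 1 1)) :=
  frameSubstRingHom_one_add_C_X 𝒪 _

/-- `φ_A (T₁) = (1+T₁)^a (1+T₂)^c − 1`. [cite: NeukirchSchmidtWingberg2008, (5.3.5)] -/
theorem frameSubst_X :
    frameSubst 𝒪 A' PowerSeries.X =
      PowerSeries.map (PowerSeries.C (R := 𝒪)) (PowerSeries.binomialSeries 𝒪 (A' 0 0)) *
        PowerSeries.C (PowerSeries.binomialSeries 𝒪 (A' 1 0)) - 1 := by
  rw [← frameSubst_one_add_X, map_add, map_one, add_sub_cancel_left]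

/-- `φ_A (T₂) = (1+T₁)^b (1+T₂)^d − 1`. [cite: NeukirchSchmidtWingberg2008, (5.3.5)] -/
theorem frameSubst_C_X :
    frameSubst 𝒪 A' (PowerSeries.C PowerSeries.X) =
      PowerSeries.map (PowerSeries.C (R := 𝒪)) (PowerSeries.binomialSeries 𝒪 (A' 0 1)) *
        PowerSeries.C (PowerSeries.binomialSeries 𝒪 (A' 1 1)) - 1 := by
  rw [← frameSubst_one_add_C_X, map_add, map_one, add_sub_cancel_left]

/-- `φ_A ((1+T₁)^x) = (1+T₁)^{ax} (1+T₂)^{cx}`. [cite: NeukirchSchmidtWingberg2008, (5.3.5)] -/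
theorem frameSubst_onePlusT₁Pow (x : ℤ_[p]) :
    frameSubst 𝒪 A' (PowerSeries.map (PowerSeries.C (R := 𝒪)) (PowerSeries.binomialSeries 𝒪 x)) =
      PowerSeries.map (PowerSeries.C (R := 𝒪)) (PowerSeries.binomialSeries 𝒪 (A' 0 0 * x)) *
        PowerSeries.C (PowerSeries.binomialSeries 𝒪 (A' 1 0 * x)) :=
  frameSubstRingHom_onePlusT₁Pow 𝒪 _ x

/-- `φ_A ((1+T₂)^x) = (1+T₁)^{bx} (1+T₂)^{dx}`. [cite: NeukirchSchmidtWingberg2008, (5.3.5)] -/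
theorem frameSubst_onePlusT₂Pow (x : ℤ_[p]) :
    frameSubst 𝒪 A' (PowerSeries.C (PowerSeries.binomialSeries 𝒪 x)) =
      PowerSeries.map (PowerSeries.C (R := 𝒪)) (PowerSeries.binomialSeries 𝒪 (A' 0 1 * x)) *
        PowerSeries.C (PowerSeries.binomialSeries 𝒪 (A' 1 1 * x)) :=
  frameSubstRingHom_onePlusT₂Pow 𝒪 _ x

end Equiv

/-! ## §6 Three named frames: the swap, the reflection `γ ↦ γ⁻¹` composed with the swap, diagonal frames -/

section Frames

/-- The SWAP frame `(0 1; 1 0)` (exchange `γ₁ ↔ γ₂`, i.e. `T₁ ↔ T₂`), an involution of `GL₂(ℤ_p)`.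
[cite: NeukirchSchmidtWingberg2008, (5.3.5)] -/
def swapFrame : GL (Fin 2) ℤ_[p] :=
  ⟨!![0, 1; 1, 0], !![0, 1; 1, 0], by simp [Matrix.one_fin_two],
    by simp [Matrix.one_fin_two]⟩

/-- The REFLECTION frame `(0 −1; −1 0)`: `γ₁ ↦ γ₂⁻¹`, `γ₂ ↦ γ₁⁻¹`, i.e. `1 + T₁ ↦ (1+T₂)⁻¹`,
`1 + T₂ ↦ (1+T₁)⁻¹` — the shape of the route's `IsReflection` (Büyükboduk–Lei's involution).
[cite: NeukirchSchmidtWingberg2008, (5.3.5)] -/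
def reflectionFrame : GL (Fin 2) ℤ_[p] :=
  ⟨!![0, -1; -1, 0], !![0, -1; -1, 0], by simp [Matrix.one_fin_two],
    by simp [Matrix.one_fin_two]⟩

/-- Entries of the swap frame. [cite: NeukirchSchmidtWingberg2008, (5.3.5)] -/
@[simp] theorem val_swapFrame : ((swapFrame : GL (Fin 2) ℤ_[p]) : Matrix (Fin 2) (Fin 2) ℤ_[p]) = !![0, 1; 1, 0] := rfl

/-- Entries of the reflection frame. [cite: NeukirchSchmidtWingberg2008, (5.3.5)] -/
@[simp] theorem val_reflectionFrame :
    ((reflectionFrame : GL (Fin 2) ℤ_[p]) : Matrix (Fin 2) (Fin 2) ℤ_[p]) = !![0, -1; -1, 0] := rfl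

/-- **(4, swap) `φ_swap (T₁) = T₂`.** [cite: NeukirchSchmidtWingberg2008, (5.3.5)] -/
theorem frameSubst_swapFrame_X :
    frameSubst 𝒪 (swapFrame (p := p)) (PowerSeries.X : PowerSeries (PowerSeries 𝒪)) = PowerSeries.C PowerSeries.X := by
  rw [frameSubst_X, val_swapFrame]
  simp only [Matrix.of_apply, Matrix.cons_val', Matrix.cons_val_zero, Matrix.cons_val_one,
    Matrix.cons_val_fin_one, PowerSeries.binomialSeries_zero, map_one, one_mul, C_binomialSeries_one,
    add_sub_cancel_left]

/-- **(4, swap) `φ_swap (T₂) = T₁`.** [cite: NeukirchSchmidtWingberg2008, (5.3.5)] -/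
theorem frameSubst_swapFrame_C_X :
    frameSubst 𝒪 (swapFrame (p := p)) (PowerSeries.C PowerSeries.X : PowerSeries (PowerSeries 𝒪)) = PowerSeries.X := by
  rw [frameSubst_C_X, val_swapFrame]
  simp only [Matrix.of_apply, Matrix.cons_val', Matrix.cons_val_zero, Matrix.cons_val_one,
    Matrix.cons_val_fin_one, PowerSeries.binomialSeries_zero, map_one, mul_one, map_C_binomialSeries_one,
    add_sub_cancel_left]

/-- **(4, reflection) `(1 + T₂) · (1 + φ_ρ T₁) = 1`** — first clause of the route's `IsReflection 𝒪 (frameSubst 𝒪 reflectionFrame)`.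
[cite: NeukirchSchmidtWingberg2008, (5.3.5)] -/
theorem one_add_C_X_mul_one_add_frameSubst_reflectionFrame_X :
    (1 + PowerSeries.C PowerSeries.X) *
      (1 + frameSubst 𝒪 (reflectionFrame (p := p)) (PowerSeries.X : PowerSeries (PowerSeries 𝒪))) = 1 := by
  rw [← map_one (frameSubst 𝒪 (reflectionFrame (p := p))), ← map_add, frameSubst_one_add_X, val_reflectionFrame]
  simp only [Matrix.of_apply, Matrix.cons_val', Matrix.cons_val_zero, Matrix.cons_val_one,
    Matrix.cons_val_fin_one, PowerSeries.binomialSeries_zero, map_one, one_mul]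
  rw [← C_binomialSeries_one 𝒪 (p := p), ← map_mul, ← PowerSeries.binomialSeries_add, add_neg_cancel,
    PowerSeries.binomialSeries_zero, map_one]

/-- **(4, reflection) `(1 + T₁) · (1 + φ_ρ T₂) = 1`** — second clause of `IsReflection`.
[cite: NeukirchSchmidtWingberg2008, (5.3.5)] -/
theorem one_add_X_mul_one_add_frameSubst_reflectionFrame_C_X :
    (1 + PowerSeries.X) *
      (1 + frameSubst 𝒪 (reflectionFrame (p := p)) (PowerSeries.C PowerSeries.X : PowerSeries (PowerSeries 𝒪))) = 1 := by
  rw [← map_one (frameSubst 𝒪 (reflectionFrame (p := p))), ← map_add, frameSubst_one_add_C_X, val_reflectionFrame]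
  simp only [Matrix.of_apply, Matrix.cons_val', Matrix.cons_val_zero, Matrix.cons_val_one,
    Matrix.cons_val_fin_one, PowerSeries.binomialSeries_zero, map_one, mul_one]
  rw [← map_C_binomialSeries_one 𝒪 (p := p), ← map_mul, ← PowerSeries.binomialSeries_add, add_neg_cancel,
    PowerSeries.binomialSeries_zero, map_one]

/-- **(4, reflection) The three `IsReflection` clauses of `Theorems/UniversalToricDescentThinCombDefs`
hold for `frameSubst 𝒪 reflectionFrame`** (spelled out; that file's `T₁ = X`, `T₂ = C X`,
`const = C ∘ C`): the route's first ACTUAL reflection. [cite: NeukirchSchmidtWingberg2008, (5.3.5)] -/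
theorem frameSubst_reflectionFrame_isReflection :
    (1 + PowerSeries.C PowerSeries.X) *
        (1 + frameSubst 𝒪 (reflectionFrame (p := p)) (PowerSeries.X : PowerSeries (PowerSeries 𝒪))) = 1 ∧
      (1 + PowerSeries.X) *
        (1 + frameSubst 𝒪 (reflectionFrame (p := p)) (PowerSeries.C PowerSeries.X : PowerSeries (PowerSeries 𝒪))) = 1 ∧
      ∀ c : 𝒪, frameSubst 𝒪 (reflectionFrame (p := p)) ((PowerSeries.C (R := PowerSeries 𝒪)).comp (PowerSeries.C (R := 𝒪)) c) =
        (PowerSeries.C (R := PowerSeries 𝒪)).comp (PowerSeries.C (R := 𝒪)) c :=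
  ⟨one_add_C_X_mul_one_add_frameSubst_reflectionFrame_X 𝒪,
    one_add_X_mul_one_add_frameSubst_reflectionFrame_C_X 𝒪, fun c ↦ frameSubst_C_C 𝒪 _ c⟩

/-- The DIAGONAL frame `diag(u, v)` of two units (`γ₁ ↦ γ₁^u`, `γ₂ ↦ γ₂^v`). [cite: NeukirchSchmidtWingberg2008, (5.3.5)] -/
def diagFrame (u v : ℤ_[p]ˣ) : GL (Fin 2) ℤ_[p] :=
  ⟨!![(u : ℤ_[p]), 0; 0, (v : ℤ_[p])], !![((u⁻¹ : ℤ_[p]ˣ) : ℤ_[p]), 0; 0, ((v⁻¹ : ℤ_[p]ˣ) : ℤ_[p])],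
    by simp [Matrix.one_fin_two], by simp [Matrix.one_fin_two]⟩

/-- Entries of the diagonal frame. [cite: NeukirchSchmidtWingberg2008, (5.3.5)] -/
@[simp] theorem val_diagFrame (u v : ℤ_[p]ˣ) :
    ((diagFrame u v : GL (Fin 2) ℤ_[p]) : Matrix (Fin 2) (Fin 2) ℤ_[p]) = !![(u : ℤ_[p]), 0; 0, (v : ℤ_[p])] := rfl

/-- **(4, axes) `φ_{diag(u,v)} (1 + T₁) = (1+T₁)^u`** — on the outer variable the diagonal frame is the
one-variable generator change `T₁ ↦ (1+T₁)^u − 1` (`GeneratorChange.subst u` of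
`IwasawaAlgebraGeneratorChange`), inner coefficients untouched. [cite: NeukirchSchmidtWingberg2008, (5.3.5)] [cite: Washington1997, §13.2] -/
theorem frameSubst_diagFrame_one_add_X (u v : ℤ_[p]ˣ) :
    frameSubst 𝒪 (diagFrame u v) (1 + PowerSeries.X) =
      PowerSeries.map (PowerSeries.C (R := 𝒪)) (PowerSeries.binomialSeries 𝒪 (u : ℤ_[p])) := by
  rw [frameSubst_one_add_X, val_diagFrame]
  simp only [Matrix.of_apply, Matrix.cons_val', Matrix.cons_val_zero, Matrix.cons_val_one,
    Matrix.cons_val_fin_one, PowerSeries.binomialSeries_zero, map_one, mul_one]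

/-- **(4, axes) `φ_{diag(u,v)} (1 + T₂) = (1+T₂)^v`** — on the inner variable it is the one-variable
generator change applied coefficientwise. [cite: NeukirchSchmidtWingberg2008, (5.3.5)] [cite: Washington1997, §13.2] -/
theorem frameSubst_diagFrame_one_add_C_X (u v : ℤ_[p]ˣ) :
    frameSubst 𝒪 (diagFrame u v) (1 + PowerSeries.C PowerSeries.X) =
      PowerSeries.C (PowerSeries.binomialSeries 𝒪 (v : ℤ_[p])) := by
  rw [frameSubst_one_add_C_X, val_diagFrame]
  simp only [Matrix.of_apply, Matrix.cons_val', Matrix.cons_val_zero, Matrix.cons_val_one,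
    Matrix.cons_val_fin_one, PowerSeries.binomialSeries_zero, map_one, one_mul]

end Frames

/-! ## §7 The weak-reflection criterion: `φ_A(T₂) ∉ (p, T₂)` iff `b ≠ 0` -/

section Criterion

/-- **Lucas at a prime power (natural exponents)**: `(n·p^e choose p^e) ≡ n (mod p)`.
[cite: Cai2020, Thm. 3.15 (Lucas), p. 98] -/
theorem choose_mul_prime_pow_modEq (e n : ℕ) : Nat.choose (n * p ^ e) (p ^ e) ≡ n [MOD p] := by
  have hp : p.Prime := Fact.out
  induction e with
  | zero => rw [pow_zero, mul_one, Nat.choose_one_right]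
  | succ e ih =>
    have h := Choose.choose_modEq_choose_mod_mul_choose_div_nat (n := n * p ^ (e + 1)) (k := p ^ (e + 1)) (p := p)
    have h1 : n * p ^ (e + 1) % p = 0 := by
      rw [pow_succ, ← mul_assoc]; exact Nat.mul_mod_left _ _
    have h2 : p ^ (e + 1) % p = 0 := by
      rw [pow_succ]; exact Nat.mul_mod_left _ _
    have h3 : n * p ^ (e + 1) / p = n * p ^ e := by
      rw [pow_succ, ← mul_assoc, Nat.mul_div_cancel _ hp.pos]
    have h4 : p ^ (e + 1) / p = p ^ e := by
      rw [pow_succ, Nat.mul_div_cancel _ hp.pos]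
    rw [h1, h2, h3, h4, Nat.choose_zero_right, one_mul] at h
    exact h.trans ih

/-- **Lucas at a prime power, `p`-adic exponents**: `p ∣ (u·p^e choose p^e) − u` in `ℤ_p` for every
`u ∈ ℤ_p` (the natural case by Lucas, then density of `ℕ` in `ℤ_p` and continuity of
`u ↦ (u·p^e choose p^e)`). [cite: Cai2020, Thm. 3.15 (Lucas), p. 98] -/
theorem prime_dvd_choose_mul_pow_sub (e : ℕ) (u : ℤ_[p]) :
    (p : ℤ_[p]) ∣ Ring.choose (u * (p : ℤ_[p]) ^ e) (p ^ e) - u := by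
  have hp : p.Prime := Fact.out
  set f : ℤ_[p] → ℤ_[p] := fun v ↦ Ring.choose (v * (p : ℤ_[p]) ^ e) (p ^ e) - v with hf
  have hfc : Continuous f :=
    ((PadicInt.continuous_choose (p ^ e)).comp (continuous_id.mul continuous_const)).sub continuous_id
  -- the closed condition `‖f v‖ ≤ p⁻¹` (equivalently `p ∣ f v`) holds on the dense subset `ℕ`
  have hclosed : IsClosed {v : ℤ_[p] | ‖f v‖ ≤ (p : ℝ) ^ (-1 : ℤ)} :=
    isClosed_le (continuous_norm.comp hfc) continuous_const
  have hnat : Set.range (Nat.cast : ℕ → ℤ_[p]) ⊆ {v : ℤ_[p] | ‖f v‖ ≤ (p : ℝ) ^ (-1 : ℤ)} := by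
    rintro _ ⟨n, rfl⟩
    simp only [Set.mem_setOf_eq, hf]
    rw [PadicInt.norm_le_pow_iff_norm_lt_pow_add_one, neg_add_cancel, zpow_zero,
      PadicInt.norm_lt_one_iff_dvd, show ((n : ℤ_[p]) * (p : ℤ_[p]) ^ e) = ((n * p ^ e : ℕ) : ℤ_[p]) by push_cast; ring,
      Ring.choose_natCast]
    have hmod := (choose_mul_prime_pow_modEq (p := p) e n).symm
    rw [Nat.modEq_iff_dvd] at hmod
    obtain ⟨c, hc⟩ := hmod
    refine ⟨(c : ℤ_[p]), ?_⟩
    have hc' : (((Nat.choose (n * p ^ e) (p ^ e) : ℕ) : ℤ) : ℤ_[p]) - ((n : ℤ) : ℤ_[p]) = ((p : ℤ) : ℤ_[p]) * (c : ℤ_[p]) := by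
      rw [← Int.cast_mul, ← hc, Int.cast_sub]
    simpa using hc'
  have hall : {v : ℤ_[p] | ‖f v‖ ≤ (p : ℝ) ^ (-1 : ℤ)} = Set.univ := by
    apply Set.eq_univ_of_univ_subset
    rw [← PadicInt.denseRange_natCast.closure_range]
    exact hclosed.closure_subset_iff.mpr hnat
  have hu : u ∈ {v : ℤ_[p] | ‖f v‖ ≤ (p : ℝ) ^ (-1 : ℤ)} := by rw [hall]; exact Set.mem_univ u
  simp only [Set.mem_setOf_eq] at hu
  rw [PadicInt.norm_le_pow_iff_norm_lt_pow_add_one, neg_add_cancel, zpow_zero,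
    PadicInt.norm_lt_one_iff_dvd] at hu
  exact hu

variable {𝒪} in
omit [Fact p.Prime] [Algebra ℤ_[p] 𝒪] in
/-- The functional `F ↦ [T₂^0]([T₁^n] F)` kills the ideal `(p, T₂)` modulo `p`: if
`F ∈ (C (C p), C X)` then `p ∣ constantCoeff (coeff n F)` (`(p, T₁, T₂)` is the maximal ideal).
[cite: Lang1990, Ch. 5 §1 (PDF p. 94)] -/
theorem prime_dvd_constantCoeff_coeff_of_mem_span {F : PowerSeries (PowerSeries 𝒪)} (n : ℕ)
    (hF : F ∈ Ideal.span {PowerSeries.C (PowerSeries.C (p : 𝒪)), PowerSeries.C PowerSeries.X}) :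
    (p : 𝒪) ∣ PowerSeries.constantCoeff (PowerSeries.coeff n F) := by
  rw [Ideal.mem_span_pair] at hF
  obtain ⟨G, H, rfl⟩ := hF
  refine ⟨PowerSeries.constantCoeff (PowerSeries.coeff n G), ?_⟩
  rw [map_add, map_add, PowerSeries.coeff_mul_C, PowerSeries.coeff_mul_C, map_mul, map_mul,
    PowerSeries.constantCoeff_C, PowerSeries.constantCoeff_X, mul_zero, add_zero, mul_comm]

/-- `[T₂^0]([T₁^n] ((1+T₁)^b (1+T₂)^d − 1)) = (b choose n)` for `n ≠ 0`. [cite: NeukirchSchmidtWingberg2008, (5.3.5)] -/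
theorem constantCoeff_coeff_frame (b d : ℤ_[p]) {n : ℕ} (hn : n ≠ 0) :
    PowerSeries.constantCoeff (PowerSeries.coeff n
      (PowerSeries.map (PowerSeries.C (R := 𝒪)) (PowerSeries.binomialSeries 𝒪 b) *
        PowerSeries.C (PowerSeries.binomialSeries 𝒪 d) - 1)) = algebraMap ℤ_[p] 𝒪 (Ring.choose b n) := by
  rw [map_sub, PowerSeries.coeff_one, if_neg hn, sub_zero, PowerSeries.coeff_mul_C, PowerSeries.coeff_map,
    PowerSeries.binomialSeries_coeff, map_mul, PowerSeries.constantCoeff_C,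
    PowerSeries.binomialSeries_constantCoeff, mul_one, Algebra.algebraMap_eq_smul_one]

/-- **(5) THE WEAK-REFLECTION CRITERION.** For `A = (a b; c d) ∈ GL₂(ℤ_p)` and a `ℤ_p`-algebra `𝒪`
in which `p` is not a unit (`ℤ_p`, `unrIntegers p`, …): `φ_A(T₂) = (1+T₁)^b (1+T₂)^d − 1` lies in the
ideal `(p, T₂)` of `Λ₂(𝒪)` iff `b = 0`. (`b = 0`: the image is `(1+T₂)^d − 1 ∈ (T₂)`. `b = u p^e ≠ 0`:
the coefficient of `T₁^{p^e} T₂^0` is `(b choose p^e) ≡ u ≢ 0 (mod p)` by Lucas.)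
[cite: NeukirchSchmidtWingberg2008, (5.3.5)] [cite: Cai2020, Thm. 3.15 (Lucas), p. 98] -/
theorem frameSubst_C_X_mem_span_iff (hp : ¬ IsUnit (p : 𝒪)) (A : GL (Fin 2) ℤ_[p]) :
    frameSubst 𝒪 A (PowerSeries.C PowerSeries.X) ∈
        Ideal.span {PowerSeries.C (PowerSeries.C (p : 𝒪)), PowerSeries.C PowerSeries.X} ↔
      (A : Matrix (Fin 2) (Fin 2) ℤ_[p]) 0 1 = 0 := by
  constructor
  · intro hmem
    by_contra hb
    set b : ℤ_[p] := (A : Matrix (Fin 2) (Fin 2) ℤ_[p]) 0 1 with hbdef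
    have hpe : p ^ b.valuation ≠ 0 := pow_ne_zero _ (Fact.out : p.Prime).ne_zero
    -- the `T₁^{p^e} T₂^0` coefficient of `φ_A(T₂)` is `(b choose p^e)`, and it is `≡ 0 (mod p)` in `𝒪`
    have h1 := prime_dvd_constantCoeff_coeff_of_mem_span (p ^ b.valuation) hmem
    rw [frameSubst_C_X, ← hbdef, constantCoeff_coeff_frame 𝒪 b _ hpe] at h1
    -- but `(b choose p^e) ≡ u (mod p)` for the unit `u = b p^{-e}`
    have h2 := prime_dvd_choose_mul_pow_sub (p := p) b.valuation (PadicInt.unitCoeff hb : ℤ_[p])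
    rw [← PadicInt.unitCoeff_spec hb] at h2
    have h3 : (p : 𝒪) ∣ algebraMap ℤ_[p] 𝒪 (PadicInt.unitCoeff hb : ℤ_[p]) := by
      have h2' := (_root_.map_dvd (algebraMap ℤ_[p] 𝒪) h2)
      rw [map_natCast, map_sub] at h2'
      have := dvd_sub h1 h2'
      rwa [sub_sub_cancel] at this
    -- so `p` divides a unit of `𝒪`: `p` is a unit, contradiction
    obtain ⟨k, hk⟩ := h3
    have hunit : IsUnit ((p : 𝒪) * k) := by
      rw [← hk]; exact (Units.isUnit _).map (algebraMap ℤ_[p] 𝒪)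
    exact hp (isUnit_of_mul_isUnit_left hunit)
  · intro hb
    rw [frameSubst_C_X, hb, PowerSeries.binomialSeries_zero, map_one, one_mul, ← map_one PowerSeries.C,
      ← map_sub]
    obtain ⟨q, hq⟩ := PowerSeries.X_dvd_iff.mpr
      (show PowerSeries.constantCoeff (PowerSeries.binomialSeries 𝒪 ((A : Matrix (Fin 2) (Fin 2) ℤ_[p]) 1 1) - 1) = 0 by
        rw [map_sub, PowerSeries.binomialSeries_constantCoeff, map_one, sub_self])
    rw [hq, map_mul]
    exact Ideal.mem_span_pair.mpr ⟨0, PowerSeries.C q, by ring⟩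

/-- **(5) as used by `thin_comb` v2**: `φ_A(T₂) ∉ (const p, T₂)` iff `b ≠ 0`. [cite: NeukirchSchmidtWingberg2008, (5.3.5)] -/
theorem frameSubst_C_X_not_mem_span_iff (hp : ¬ IsUnit (p : 𝒪)) (A : GL (Fin 2) ℤ_[p]) :
    frameSubst 𝒪 A (PowerSeries.C PowerSeries.X) ∉
        Ideal.span {PowerSeries.C (PowerSeries.C (p : 𝒪)), PowerSeries.C PowerSeries.X} ↔
      (A : Matrix (Fin 2) (Fin 2) ℤ_[p]) 0 1 ≠ 0 :=
  not_congr (frameSubst_C_X_mem_span_iff 𝒪 hp A)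

/-- In `ℤ_p` itself `p` is not a unit (hypothesis of the criterion for `𝒪 = ℤ_p`). [cite: Lang1990, Ch. 5 §1 (PDF p. 94)] -/
theorem not_isUnit_natCast_padicInt : ¬ IsUnit ((p : ℕ) : ℤ_[p]) := by
  rw [PadicInt.isUnit_iff, PadicInt.norm_p]
  have hp : (1 : ℝ) < p := by exact_mod_cast (Fact.out : p.Prime).one_lt
  exact ne_of_lt (inv_lt_one_of_one_lt₀ hp)

end Criterion

/-! ## §8 Galois dictionary: the matrix of an endomorphism of `Γ = Gal(K̃_∞/K) ≅ ℤ_p²` in a generator pair -/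

section Galois

variable {K : Type*} [Field K]

/-- **The frame matrix `A_σ` of a map `σ` on `Γ_K` with respect to a generator pair
`(κ₁, κ₂; γ₁, γ₂)`** of the `ℤ_p²`-tower (`ZpExtension.IsTopGeneratorPair κ₁ κ₂ γ₁ γ₂` of
`Rubin1991/TwoVariableMainConjecture`): in additive (`log_γ`) coordinates
`a = κ₁(σγ₁)`, `c = κ₂(σγ₁)`, `b = κ₁(σγ₂)`, `d = κ₂(σγ₂)`, i.e. column `j` = the coordinates of
`σ(γ_j) ≡ γ₁^{A 0 j} γ₂^{A 1 j} (mod Gal(K̄/K̃_∞))`. For `σ` an automorphism of `Γ_K` preserving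
`Gal(K̄/K̃_∞)` (conjugation by a complex conjugation `c`, or `g ↦ c g⁻¹ c⁻¹`) the induced automorphism
of `𝒪⟦Gal(K̃_∞/K)⟧ ≅ Λ₂(𝒪)` (`γ_i ↦ 1 + T_i`) is `frameSubst 𝒪 A_σ` — «the pinned `c∘ι` substitution of
a frame». Statement-level bookkeeping for the route's frame stubs; nothing is asserted.
[cite: NeukirchSchmidtWingberg2008, (5.3.5)] [cite: Washington1997, §13.2] -/
def frameMatrixOf (κ₁ κ₂ : ZpExtension K p) (γ₁ γ₂ : Field.absoluteGaloisGroup K)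
    (σ : Field.absoluteGaloisGroup K → Field.absoluteGaloisGroup K) : Matrix (Fin 2) (Fin 2) ℤ_[p] :=
  !![Multiplicative.toAdd (κ₁ (σ γ₁)), Multiplicative.toAdd (κ₁ (σ γ₂));
    Multiplicative.toAdd (κ₂ (σ γ₁)), Multiplicative.toAdd (κ₂ (σ γ₂))]

variable (κ₁ κ₂ : ZpExtension K p) (γ₁ γ₂ : Field.absoluteGaloisGroup K)
  (σ : Field.absoluteGaloisGroup K → Field.absoluteGaloisGroup K)

/-- `a = κ₁(σγ₁)`. [cite: NeukirchSchmidtWingberg2008, (5.3.5)] -/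
@[simp] theorem frameMatrixOf_apply_zero_zero :
    frameMatrixOf κ₁ κ₂ γ₁ γ₂ σ 0 0 = Multiplicative.toAdd (κ₁ (σ γ₁)) := rfl

/-- `b = κ₁(σγ₂)`. [cite: NeukirchSchmidtWingberg2008, (5.3.5)] -/
@[simp] theorem frameMatrixOf_apply_zero_one :
    frameMatrixOf κ₁ κ₂ γ₁ γ₂ σ 0 1 = Multiplicative.toAdd (κ₁ (σ γ₂)) := rfl

/-- `c = κ₂(σγ₁)`. [cite: NeukirchSchmidtWingberg2008, (5.3.5)] -/
@[simp] theorem frameMatrixOf_apply_one_zero :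
    frameMatrixOf κ₁ κ₂ γ₁ γ₂ σ 1 0 = Multiplicative.toAdd (κ₂ (σ γ₁)) := rfl

/-- `d = κ₂(σγ₂)`. [cite: NeukirchSchmidtWingberg2008, (5.3.5)] -/
@[simp] theorem frameMatrixOf_apply_one_one :
    frameMatrixOf κ₁ κ₂ γ₁ γ₂ σ 1 1 = Multiplicative.toAdd (κ₂ (σ γ₂)) := rfl

/-- Sanity: for an ADAPTED generator pair (`κ₁ γ₁ = 1`, `κ₂ γ₁ = 0`, `κ₁ γ₂ = 0`, `κ₂ γ₂ = 1` additively —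
the four clauses of `ZpExtension.IsTopGeneratorPair`) the identity map has frame matrix `1`, so
`frameSubst 𝒪 1 = id`. [cite: NeukirchSchmidtWingberg2008, (5.3.5)] -/
theorem frameMatrixOf_id (h₁ : κ₁.IsTopGenerator γ₁) (h₂ : κ₂ γ₁ = 1) (h₃ : κ₁ γ₂ = 1)
    (h₄ : κ₂.IsTopGenerator γ₂) : frameMatrixOf κ₁ κ₂ γ₁ γ₂ id = 1 := by
  rw [ZpExtension.IsTopGenerator] at h₁ h₄
  ext i j
  fin_cases i <;> fin_cases j
  · simp [frameMatrixOf, h₁]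
  · simp [frameMatrixOf, h₃]
  · simp [frameMatrixOf, h₂]
  · simp [frameMatrixOf, h₄]

end Galois

end IwasawaAlgebra₂

end Literature.NumberTheory.EllipticCurves

end
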